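import Literature.MathematicalPhysics.QuantumFieldTheory.Balaban1983to89.Node00.BackgroundSelOfRecord
import Literature.MathematicalPhysics.QuantumFieldTheory.Balaban1983to89.B15Claim189UnitTestAtRecord

/-!
# NODE 00 — THE SOLVABLE SET OF THE (0.21) PROBLEM OF RECORD `{V | UkExists F N K k ε V}` IS MEASURABLE — UNCONDITIONALLY (via any measurable selector:
# `Sol = f⁻¹({1}ᶜ) ∪ (Sol ∩ {1})`), with the corollaries a bookkeeping-set owner needs (`MeasurableSet (Sol ∩ D)`, measurable indicator)

Cell `pub-ymgap` (YM-PLAN Track A), seat `pub-ymgap-dag-n09-w4` (g2; D-0149 width seat of node N09), FILE 6; helper of K1⁷ `StabilityBAtRecordR13SepCoPH` =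
stmt-QuantumFields-20542 (count-neutral).  [I] = [Balaban1987RG1] (CMP 109), [B11] = [Balaban1985Variational] (CMP 102).  APPEND-ONLY growth: a NEW importing module over this
seat's `Node00/BackgroundSelOfRecord` (`exists_measurable_ukSelector`) and dag-n12-e's `B15Claim189UnitTestAtRecord` (`iter_avOfRecord_one`); nothing landed is edited.

WHY.  The on-domain junctions of N09's Theorem-3 member (dag-n09-w2 p591459 ∕ p593803, dag-n09-w3's OnDomains doors) run the flow on bookkeeping sets `D (j+1)` that must be
MEASURABLE (`hDm`), gauge-stable and INSIDE the solvable set `{UkExists …}` at the cut-off's radius (`hDsol`); the natural candidates are intersections with the solvable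
set itself — whose measurability is NOT obvious: `UkExists … V = ∃ U₀, IsBackground … V U₀` quantifies over the fine configurations, and the minimising clause is a
projection (analytic-set shape).  THIS FILE proves it IS measurable, with no hypothesis, by the selector of FILE 3: for ANY `f` with the contract (minimiser on the
solvable set, `1` off it), `V` solvable and `f V = 1` force `V = M^k(f V) = M^k 1 = 1`; so `Sol = f⁻¹({1}ᶜ) ∪ (Sol ∩ {1})` — a measurable preimage plus a subsingleton.
* `ukExists_of_sel_ne_one`, `eq_one_of_ukExists_of_sel_eq_one`, `setOf_ukExists_eq` (the decomposition), ★★ `measurableSet_ukExists`, `measurableSet_ukExists_inter`,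
  `measurable_indicator_ukExists` (the 0∕1 density of the solvable set), `measurableSet_not_ukExists`.

HONEST FRAMING — what this is NOT.  Kernel measure theory (Borel singletons on the compact metrisable `SU(N)^{bonds}`, preimages); NOTHING of Bałaban's asserted — [B11]
Thm 1 (WHICH fields are solvable) is not touched: the theorem says the set is measurable, not what it is; OPENNESS of the solvable set is NOT claimed; no estimate;
NO carrier of record re-pointed; NOT a discharge of any node; K0⁷ ∕ K1⁷ NOT closed; counts unmoved (typed 28∕28 · discharged 5∕27); one finite four-torus programme at fixed
`ε = L^{−K}` — R4 is the conditional rung `BalabanLadder.UV` only; NOT continuum ∕ ℝ⁴ ∕ OS; the YM mass gap (Clay) is NOT proved by any of this.  THEOREMS ONLY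
(0 `def`, 0 `sorry`, 0 `instance` — local `haveI` —, 0 `notation`).
-/

noncomputable section

open MeasureTheory Set

namespace Literature.MathematicalPhysics.QuantumFieldTheory.Balaban1983to89.Node00

open T4Continuum (T4Family)
open B15Claim189UnitTestAtRecord (iter_avOfRecord_one)
open Literature.MathematicalPhysics.QuantumLattice (fundamentalRep continuous_fundamentalRep fundamentalRep_injective)

variable {F : T4Family} {N : ℕ} [NeZero N] {K k : ℕ} {ε : ℝ}

/-- A selector with the contract is `≠ 1` only on the solvable set (contrapositive of the junk clause). [cite: Balaban1987RG1, (0.21) p.256 (bookkeeping)] -/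
theorem ukExists_of_sel_ne_one {f : GaugeField (F.P K) k (SU N) → GaugeField (F.P K) 0 (SU N)} (hout : ∀ V, ¬ UkExists F N K k ε V → f V = 1)
    {V : GaugeField (F.P K) k (SU N)} (h : f V ≠ 1) : UkExists F N K k ε V :=
  Classical.by_contradiction fun hV => h (hout V hV)

/-- On the solvable set a selector with value `1` sits over `V = 1`: `V = M^k(f V) = M^k 1 = 1` (dag-n12-e `iter_avOfRecord_one`). [cite: Balaban1987RG1, (0.21) p.256 (bookkeeping)] -/
theorem eq_one_of_ukExists_of_sel_eq_one {f : GaugeField (F.P K) k (SU N) → GaugeField (F.P K) 0 (SU N)}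
    (hsel : ∀ V, UkExists F N K k ε V → IsBackground (avOfRecord F N K) (bgReg F N K k ε) k V (f V))
    {V : GaugeField (F.P K) k (SU N)} (hV : UkExists F N K k ε V) (h1 : f V = 1) : V = 1 := by
  have h := (hsel V hV).1
  rw [h1, iter_avOfRecord_one F N K k] at h
  exact h.symm

/-- **THE DECOMPOSITION**: for any selector `f` with the contract, `{UkExists} = f⁻¹({1}ᶜ) ∪ ({UkExists} ∩ {1})`. [cite: Balaban1987RG1, (0.21) p.256 (bookkeeping)] -/
theorem setOf_ukExists_eq {f : GaugeField (F.P K) k (SU N) → GaugeField (F.P K) 0 (SU N)}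
    (hsel : ∀ V, UkExists F N K k ε V → IsBackground (avOfRecord F N K) (bgReg F N K k ε) k V (f V))
    (hout : ∀ V, ¬ UkExists F N K k ε V → f V = 1) :
    {V : GaugeField (F.P K) k (SU N) | UkExists F N K k ε V} =
      f ⁻¹' {(1 : GaugeField (F.P K) 0 (SU N))}ᶜ ∪ ({V | UkExists F N K k ε V} ∩ {1}) := by
  ext V
  simp only [mem_setOf_eq, mem_union, mem_preimage, mem_compl_iff, mem_singleton_iff, mem_inter_iff]
  constructor
  · intro hV
    by_cases h1 : f V = 1
    · exact Or.inr ⟨hV, eq_one_of_ukExists_of_sel_eq_one hsel hV h1⟩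
    · exact Or.inl h1
  · rintro (h | ⟨hV, -⟩)
    · exact ukExists_of_sel_ne_one hout h
    · exact hV

omit [NeZero N] in
/-- The configuration spaces `SU(N)^{bonds}` separate points measurably (Borel σ-algebra of a metrisable product; singletons are measurable). [cite: Balaban1987RG1, (0.1) p.251 (bookkeeping)] -/
private theorem measurableSingletonClass_gaugeField' (P : Params) (j : ℕ) : MeasurableSingletonClass (GaugeField P j (SU N)) := by
  have hemb : Topology.IsClosedEmbedding (fundamentalRep (Fin N)) :=
    (continuous_fundamentalRep (Fin N)).isClosedEmbedding (fundamentalRep_injective (Fin N))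
  haveI : SecondCountableTopology (SU N) := by
    haveI := secondCountableTopology_matrix (n := Fin N)
    exact hemb.isEmbedding.secondCountableTopology
  haveI : BorelSpace (GaugeField P j (SU N)) := inferInstanceAs (BorelSpace (PBond P j → SU N))
  infer_instance

/-- **★★ THE SOLVABLE SET OF (0.21) IS MEASURABLE — NO HYPOTHESIS.**  `{V | UkExists F N K k ε V}` is a measurable subset of the step-`k` configuration space, for every
torus `K`, level `k` and radius `ε` (decomposition through FILE 3's measurable selector: a measurable preimage plus a subsingleton).  [B11] Thm 1 — WHICH `V` are solvable —
is not used and not asserted. [cite: Balaban1987RG1, (0.21) p.256; Balaban1985Variational, Thm 1 p.279] -/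
theorem measurableSet_ukExists (K k : ℕ) (ε : ℝ) : MeasurableSet {V : GaugeField (F.P K) k (SU N) | UkExists F N K k ε V} := by
  haveI := measurableSingletonClass_gaugeField' (N := N) (F.P K) k
  haveI := measurableSingletonClass_gaugeField' (N := N) (F.P K) 0
  obtain ⟨f, hfm, hsel, hout⟩ := exists_measurable_ukSelector (F := F) (N := N) K k ε
  rw [setOf_ukExists_eq hsel hout]
  refine (hfm (measurableSet_singleton _).compl).union ?_
  exact Set.Subsingleton.measurableSet ((Set.subsingleton_singleton (a := (1 : GaugeField (F.P K) k (SU N)))).anti inter_subset_right)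

/-- The UNSOLVABLE set is measurable. [cite: Balaban1987RG1, (0.21) p.256 (bookkeeping)] -/
theorem measurableSet_not_ukExists (K k : ℕ) (ε : ℝ) : MeasurableSet {V : GaugeField (F.P K) k (SU N) | ¬ UkExists F N K k ε V} :=
  (measurableSet_ukExists (F := F) (N := N) K k ε).compl

/-- **Bookkeeping sets cut by solvability stay measurable**: `MeasurableSet (D ∩ {UkExists})` for measurable `D` — the `hDm` letter of the on-domain junctions survives the
`hDsol` cut. [cite: Balaban1987RG1, (2.16) p.269 (bookkeeping)] -/
theorem measurableSet_inter_ukExists (K k : ℕ) (ε : ℝ) {D : Set (GaugeField (F.P K) k (SU N))} (hD : MeasurableSet D) :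
    MeasurableSet (D ∩ {V | UkExists F N K k ε V}) :=
  hD.inter (measurableSet_ukExists K k ε)

open Classical in
/-- The 0∕1 density of the solvable set, `V ↦ 𝟙[UkExists … V]`, is measurable. [cite: Balaban1987RG1, (0.21) p.256 (bookkeeping)] -/
theorem measurable_indicator_ukExists (K k : ℕ) (ε : ℝ) :
    Measurable fun V : GaugeField (F.P K) k (SU N) => if UkExists F N K k ε V then (1 : ℝ) else 0 :=
  Measurable.ite (measurableSet_ukExists K k ε) measurable_const measurable_const

/-- At level `0` the solvable set is the regular class itself (node00-def-B `ukExists_zero_iff`), hence OPEN there (`bgReg` = finitely many strict inequalities); openness at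
`k ≥ 1` is NOT claimed anywhere in this file. [cite: Balaban1987RG1, (0.21) p.256 and (1.2) p.260 (bookkeeping)] -/
theorem setOf_ukExists_zero (K : ℕ) (ε : ℝ) : {V : GaugeField (F.P K) 0 (SU N) | UkExists F N K 0 ε V} = bgReg F N K 0 ε := by
  ext V
  exact ukExists_zero_iff

end Literature.MathematicalPhysics.QuantumFieldTheory.Balaban1983to89.Node00

end
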